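import Mathlib
import Literature.Analysis.OperatorTheory.KernelEnergyMomentumPair
import HarnessLib

/-!
# Bounded operators on a kernel Hilbert space from bounded matrices

The companion of `KernelEnergyMomentumPair` (relabelling operators) for the second way in which the
Osterwalder–Schrader operator calculus produces bounded operators: from a **matrix of would-be matrix
elements**. Setting: a complex Hilbert space `H` with kernel vectors `δ : X → H` whose finite
combinations `Finsupp.linearCombination ℂ δ c` are dense (Glimm–Jaffe, *Quantum Physics* (1987), §6.1;
Osterwalder–Schrader, CMP 31 (1973), §4.1, and CMP 42 (1975), §V for the field operators obtained from
bounds on matrix elements).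

## Contents (namespace `Literature.Analysis.OperatorTheory.KernelVectors`; all proved)

* `ext_inner_gen`, `ext_inner_gen_left`, `clm_eq_of_inner_gen_eq`: vectors and bounded operators are
  determined by their inner products with / matrix elements on the kernel vectors.
* `exists_clm_of_inner_bound`: a matrix `m : X → X → ℂ` with
  `‖Σₓᵧ conj cₓ c'ᵧ m x y‖ ≤ M ‖Σ cₓ δₓ‖ ‖Σ c'ᵧ δᵧ‖` is the matrix of a unique bounded operator `T`,
  `⟪δₓ, T δᵧ⟫ = m x y`, `‖T‖ ≤ M` (Riesz representation on the dense span, `LinearMap.extendOfNorm`,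
  and the adjoint).
* `norm_sum_sum_conj_mul_le_of_real`: for a REAL Gram matrix `⟪δₓ, δᵧ⟫ ∈ ℝ` and a real matrix `m`, a
  bound over real coefficient families implies the bound over complex ones with constant `4M`
  (split into real and imaginary parts; `‖Σ Re cᵢ δᵢ‖, ‖Σ Im cᵢ δᵢ‖ ≤ ‖Σ cᵢ δᵢ‖` because the cross
  term is purely imaginary); `exists_clm_of_real_bound` combines the two.

## References
* J. Glimm, A. Jaffe, *Quantum Physics* (2nd ed. 1987), §6.1 (OS reconstruction), §19.1 (fields
  from bounds on matrix elements).
* K. Osterwalder, R. Schrader, CMP 31 (1973) §4.1; CMP 42 (1975) §V.1.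
-/

noncomputable section

open Filter ComplexConjugate
open scoped InnerProductSpace Topology

namespace Literature.Analysis.OperatorTheory

namespace KernelVectors

variable {X : Type*} {H : Type*} [NormedAddCommGroup H] [InnerProductSpace ℂ H]

/-! ## Vectors and operators are determined on the kernel vectors -/

/-- A vector is determined by its inner products with the kernel vectors (dense span). [folklore] -/
theorem ext_inner_gen (δ : X → H) (hδ : DenseRange (Finsupp.linearCombination ℂ δ)) {v w : H}
    (h : ∀ x, ⟪δ x, v⟫_ℂ = ⟪δ x, w⟫_ℂ) : v = w := by
  have key : ∀ c : X →₀ ℂ,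
      ⟪Finsupp.linearCombination ℂ δ c, v⟫_ℂ = ⟪Finsupp.linearCombination ℂ δ c, w⟫_ℂ := by
    intro c
    rw [Finsupp.linearCombination_apply, Finsupp.sum, sum_inner, sum_inner]
    refine Finset.sum_congr rfl fun x _ => ?_
    rw [inner_smul_left, inner_smul_left, h x]
  have hall : ∀ φ : H, ⟪φ, v⟫_ℂ = ⟪φ, w⟫_ℂ := fun φ =>
    hδ.induction_on φ
      (isClosed_eq (continuous_id.inner continuous_const) (continuous_id.inner continuous_const)) key
  exact ext_inner_left ℂ hall

/-- A vector is determined by the inner products of it with the kernel vectors (left slot). [folklore] -/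
theorem ext_inner_gen_left (δ : X → H) (hδ : DenseRange (Finsupp.linearCombination ℂ δ)) {v w : H}
    (h : ∀ x, ⟪v, δ x⟫_ℂ = ⟪w, δ x⟫_ℂ) : v = w :=
  ext_inner_gen δ hδ fun x => by rw [← inner_conj_symm, h x, inner_conj_symm]

/-- Two bounded operators with the same matrix elements on the kernel vectors are equal. [folklore] -/
theorem clm_eq_of_inner_gen_eq (δ : X → H) (hδ : DenseRange (Finsupp.linearCombination ℂ δ))
    {T T' : H →L[ℂ] H} (h : ∀ x y, ⟪δ x, T (δ y)⟫_ℂ = ⟪δ x, T' (δ y)⟫_ℂ) : T = T' := by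
  have hy : ∀ y, T (δ y) = T' (δ y) := fun y => ext_inner_gen δ hδ fun x => h x y
  refine clm_eq_of_eq_on_lc δ hδ fun c => ?_
  simp only [Finsupp.linearCombination_apply, Finsupp.sum, map_sum, map_smul, hy]

/-- A bounded operator maps a kernel vector to the vector with the prescribed inner products. [folklore] -/
theorem clm_apply_gen_eq (δ : X → H) (hδ : DenseRange (Finsupp.linearCombination ℂ δ))
    {T : H →L[ℂ] H} {y : X} {v : H} (h : ∀ x, ⟪δ x, T (δ y)⟫_ℂ = ⟪δ x, v⟫_ℂ) : T (δ y) = v :=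
  ext_inner_gen δ hδ h

/-! ## Operators from bounded matrices -/

/-- **A bounded matrix on the kernel vectors is the matrix of a bounded operator.** If
`m : X → X → ℂ` satisfies `‖Σₓ Σᵧ conj cₓ · c'ᵧ · m x y‖ ≤ M ‖Σ cₓ δₓ‖ ‖Σ c'ᵧ δᵧ‖` for all finitely
supported `c, c'`, then there is a bounded operator `T` with `⟪δₓ, T δᵧ⟫ = m x y` and `‖T‖ ≤ M`
(Riesz representation of `c' ↦ s(c, c')` on the completion, linearity of the Riesz vector in `c`,
extension by `LinearMap.extendOfNorm`, and the adjoint). It is unique by `clm_eq_of_inner_gen_eq`.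
(Glimm–Jaffe 1987 §19.1; Osterwalder–Schrader 1975 §V.1: operators from bounds on matrix elements
between vectors of the dense domain.) [cite: GlimmJaffe1987, §19.1] -/
theorem exists_clm_of_inner_bound [CompleteSpace H] (δ : X → H)
    (hδ : DenseRange (Finsupp.linearCombination ℂ δ)) (m : X → X → ℂ) {M : ℝ} (hM : 0 ≤ M)
    (hb : ∀ c c' : X →₀ ℂ, ‖∑ x ∈ c.support, ∑ y ∈ c'.support, conj (c x) * c' y * m x y‖ ≤
      M * ‖Finsupp.linearCombination ℂ δ c‖ * ‖Finsupp.linearCombination ℂ δ c'‖) :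
    ∃ T : H →L[ℂ] H, (∀ x y, ⟪δ x, T (δ y)⟫_ℂ = m x y) ∧ ‖T‖ ≤ M := by
  classical
  set lc := Finsupp.linearCombination ℂ δ with hlc
  -- the coefficient form, linear in the second variable
  let sL : (X →₀ ℂ) → (X →₀ ℂ) →ₗ[ℂ] ℂ := fun c =>
    c.sum fun x a => conj a • Finsupp.linearCombination ℂ (m x)
  have sL_apply : ∀ c c', sL c c' = ∑ x ∈ c.support, ∑ y ∈ c'.support, conj (c x) * c' y * m x y := by
    intro c c'
    simp only [sL, Finsupp.sum, LinearMap.coe_sum, Finset.sum_apply, LinearMap.smul_apply,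
      Finsupp.linearCombination_apply, smul_eq_mul, Finset.mul_sum]
    refine Finset.sum_congr rfl fun x _ => Finset.sum_congr rfl fun y _ => ?_
    ring
  have sL_bound : ∀ c c', ‖sL c c'‖ ≤ M * ‖lc c‖ * ‖lc c'‖ := fun c c' => by
    rw [sL_apply]; exact hb c c'
  have sL_add : ∀ c₁ c₂, sL (c₁ + c₂) = sL c₁ + sL c₂ := by
    intro c₁ c₂
    simp only [sL]
    rw [Finsupp.sum_add_index']
    · intro x; simp
    · intro x a b; simp [add_smul]
  have sL_smul : ∀ (a : ℂ) c, sL (a • c) = conj a • sL c := by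
    intro a c
    simp only [sL]
    rw [Finsupp.sum_smul_index' (fun x => by simp), Finsupp.smul_sum]
    refine Finset.sum_congr rfl fun x _ => ?_
    show conj (a • c x) • _ = conj a • conj (c x) • _
    rw [smul_eq_mul, map_mul, mul_smul]
  -- extension of `sL c` to `H`
  let L : (X →₀ ℂ) → H →L[ℂ] ℂ := fun c => (sL c).extendOfNorm lc
  have L_apply : ∀ c c', L c (lc c') = sL c c' := fun c c' =>
    LinearMap.extendOfNorm_eq hδ ⟨M * ‖lc c‖, fun c' => sL_bound c c'⟩ c'
  have L_norm : ∀ c, ‖L c‖ ≤ M * ‖lc c‖ := fun c =>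
    LinearMap.opNorm_extendOfNorm_le hδ (by positivity) (fun c' => sL_bound c c')
  -- Riesz vectors `w c`, `⟪w c, ψ⟫ = L c ψ`
  let w : (X →₀ ℂ) → H := fun c => (InnerProductSpace.toDual ℂ H).symm (L c)
  have w_inner : ∀ c ψ, ⟪w c, ψ⟫_ℂ = L c ψ := fun c ψ => InnerProductSpace.toDual_symm_apply
  have w_norm : ∀ c, ‖w c‖ ≤ M * ‖lc c‖ := fun c => by
    have : ‖w c‖ = ‖L c‖ := (InnerProductSpace.toDual ℂ H).symm.norm_map (L c)
    rw [this]; exact L_norm c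
  have w_gen : ∀ c y, ⟪w c, δ y⟫_ℂ = sL c (Finsupp.single y 1) := fun c y => by
    rw [w_inner, ← lc_single δ y, L_apply]
  have w_add : ∀ c₁ c₂, w (c₁ + c₂) = w c₁ + w c₂ := fun c₁ c₂ =>
    ext_inner_gen_left δ hδ fun y => by
      rw [inner_add_left, w_gen, w_gen, w_gen, sL_add, LinearMap.add_apply]
  have w_smul : ∀ (a : ℂ) c, w (a • c) = a • w c := fun a c =>
    ext_inner_gen_left δ hδ fun y => by
      rw [inner_smul_left, w_gen, w_gen, sL_smul, LinearMap.smul_apply, smul_eq_mul]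
  let W₀ : (X →₀ ℂ) →ₗ[ℂ] H :=
    { toFun := w, map_add' := w_add, map_smul' := w_smul }
  let A : H →L[ℂ] H := W₀.extendOfNorm lc
  have A_apply : ∀ c, A (lc c) = w c := fun c =>
    LinearMap.extendOfNorm_eq hδ ⟨M, fun c => w_norm c⟩ c
  have A_norm : ‖A‖ ≤ M := LinearMap.opNorm_extendOfNorm_le hδ hM (fun c => w_norm c)
  refine ⟨ContinuousLinearMap.adjoint A, fun x y => ?_, ?_⟩
  · rw [ContinuousLinearMap.adjoint_inner_right, ← lc_single δ x, A_apply, w_gen, sL_apply]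
    simp
  · rw [LinearIsometryEquiv.norm_map]
    exact A_norm

/-! ## Real Gram matrices: from real to complex coefficients -/

/-- For kernel vectors with real Gram matrix, the real and imaginary parts of a combination are
shorter than the combination: `‖Σ (Re cᵢ) δᵢ‖, ‖Σ (Im cᵢ) δᵢ‖ ≤ ‖Σ cᵢ δᵢ‖` (the cross term
`⟪Σ Re cᵢ δᵢ, i Σ Im cⱼ δⱼ⟫` is purely imaginary). [folklore] -/
theorem norm_sum_re_smul_le (δ : X → H) (hreal : ∀ x y, (⟪δ x, δ y⟫_ℂ).im = 0)
    {k : ℕ} (xs : Fin k → X) (c : Fin k → ℂ) :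
    ‖∑ i, ((c i).re : ℂ) • δ (xs i)‖ ≤ ‖∑ i, c i • δ (xs i)‖ ∧
      ‖∑ i, ((c i).im : ℂ) • δ (xs i)‖ ≤ ‖∑ i, c i • δ (xs i)‖ := by
  set u : H := ∑ i, ((c i).re : ℂ) • δ (xs i) with hu
  set v : H := ∑ i, ((c i).im : ℂ) • δ (xs i) with hv
  have hsplit : ∑ i, c i • δ (xs i) = u + Complex.I • v := by
    rw [hu, hv, Finset.smul_sum, ← Finset.sum_add_distrib]
    refine Finset.sum_congr rfl fun i _ => ?_
    rw [smul_smul, ← add_smul]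
    congr 1
    rw [mul_comm]
    exact (Complex.re_add_im (c i)).symm
  have huv : (⟪u, v⟫_ℂ).im = 0 := by
    rw [hu, hv, sum_inner, Complex.im_sum]
    refine Finset.sum_eq_zero fun i _ => ?_
    rw [inner_sum, Complex.im_sum]
    refine Finset.sum_eq_zero fun j _ => ?_
    rw [inner_smul_left, inner_smul_right, Complex.conj_ofReal]
    simp [Complex.mul_im, hreal]
  have hnorm : ‖u + Complex.I • v‖ ^ 2 = ‖u‖ ^ 2 + ‖v‖ ^ 2 := by
    rw [@norm_add_sq ℂ, inner_smul_right, norm_smul, Complex.norm_I, one_mul]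
    have : RCLike.re (Complex.I * ⟪u, v⟫_ℂ) = 0 := by
      rw [RCLike.re_to_complex, Complex.mul_re, Complex.I_re, Complex.I_im, huv]
      ring
    rw [this]; ring
  rw [hsplit]
  have h0u : 0 ≤ ‖u‖ := norm_nonneg _
  have h0v : 0 ≤ ‖v‖ := norm_nonneg _
  have h0 : 0 ≤ ‖u + Complex.I • v‖ := norm_nonneg _
  constructor <;> nlinarith [hnorm]

/-- **Real-to-complex upgrade of a matrix bound.** For kernel vectors with real Gram matrix and a real
matrix `m`, a bound `|Σᵢⱼ rᵢ r'ⱼ m(xᵢ, yⱼ)| ≤ M ‖Σ rᵢ δ_{xᵢ}‖ ‖Σ r'ⱼ δ_{yⱼ}‖` over REAL coefficient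
families implies `‖Σᵢⱼ conj cᵢ · c'ⱼ · m(xᵢ, yⱼ)‖ ≤ 4M ‖Σ cᵢ δ_{xᵢ}‖ ‖Σ c'ⱼ δ_{yⱼ}‖` over complex ones
(real and imaginary parts, `norm_sum_re_smul_le`). [folklore] -/
theorem norm_sum_sum_conj_mul_le_of_real (δ : X → H) (hreal : ∀ x y, (⟪δ x, δ y⟫_ℂ).im = 0)
    (m : X → X → ℝ) {M : ℝ} (hM : 0 ≤ M)
    (hb : ∀ (k : ℕ) (xs : Fin k → X) (r : Fin k → ℝ) (l : ℕ) (ys : Fin l → X) (r' : Fin l → ℝ),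
      |∑ i, ∑ j, r i * r' j * m (xs i) (ys j)| ≤
        M * ‖∑ i, (r i : ℂ) • δ (xs i)‖ * ‖∑ j, (r' j : ℂ) • δ (ys j)‖)
    {k : ℕ} (xs : Fin k → X) (c : Fin k → ℂ) {l : ℕ} (ys : Fin l → X) (c' : Fin l → ℂ) :
    ‖∑ i, ∑ j, conj (c i) * c' j * (m (xs i) (ys j) : ℂ)‖ ≤
      4 * M * ‖∑ i, c i • δ (xs i)‖ * ‖∑ j, c' j • δ (ys j)‖ := by
  set z : ℂ := ∑ i, ∑ j, conj (c i) * c' j * (m (xs i) (ys j) : ℂ) with hz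
  set a : Fin k → ℝ := fun i => (c i).re
  set b : Fin k → ℝ := fun i => (c i).im
  set a' : Fin l → ℝ := fun j => (c' j).re
  set b' : Fin l → ℝ := fun j => (c' j).im
  have hre : z.re = ∑ i, ∑ j, a i * a' j * m (xs i) (ys j) + ∑ i, ∑ j, b i * b' j * m (xs i) (ys j) := by
    rw [hz, Complex.re_sum, ← Finset.sum_add_distrib]
    refine Finset.sum_congr rfl fun i _ => ?_
    rw [Complex.re_sum, ← Finset.sum_add_distrib]
    refine Finset.sum_congr rfl fun j _ => ?_
    simp only [Complex.mul_re, Complex.mul_im, Complex.conj_re, Complex.conj_im, Complex.ofReal_re,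
      Complex.ofReal_im, a, b, a', b']
    ring
  have him : z.im = ∑ i, ∑ j, a i * b' j * m (xs i) (ys j) - ∑ i, ∑ j, b i * a' j * m (xs i) (ys j) := by
    rw [hz, Complex.im_sum, ← Finset.sum_sub_distrib]
    refine Finset.sum_congr rfl fun i _ => ?_
    rw [Complex.im_sum, ← Finset.sum_sub_distrib]
    refine Finset.sum_congr rfl fun j _ => ?_
    simp only [Complex.mul_re, Complex.mul_im, Complex.conj_re, Complex.conj_im, Complex.ofReal_re,
      Complex.ofReal_im, a, b, a', b']
    ring
  obtain ⟨hua, hub⟩ := norm_sum_re_smul_le δ hreal xs c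
  obtain ⟨hva, hvb⟩ := norm_sum_re_smul_le δ hreal ys c'
  set NU := ‖∑ i, c i • δ (xs i)‖
  set NV := ‖∑ j, c' j • δ (ys j)‖
  have h1 := hb k xs a l ys a'
  have h2 := hb k xs b l ys b'
  have h3 := hb k xs a l ys b'
  have h4 := hb k xs b l ys a'
  have e1 : |∑ i, ∑ j, a i * a' j * m (xs i) (ys j)| ≤ M * NU * NV :=
    h1.trans (by gcongr)
  have e2 : |∑ i, ∑ j, b i * b' j * m (xs i) (ys j)| ≤ M * NU * NV :=
    h2.trans (by gcongr)
  have e3 : |∑ i, ∑ j, a i * b' j * m (xs i) (ys j)| ≤ M * NU * NV :=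
    h3.trans (by gcongr)
  have e4 : |∑ i, ∑ j, b i * a' j * m (xs i) (ys j)| ≤ M * NU * NV :=
    h4.trans (by gcongr)
  calc ‖z‖ ≤ |z.re| + |z.im| := Complex.norm_le_abs_re_add_abs_im z
    _ ≤ (M * NU * NV + M * NU * NV) + (M * NU * NV + M * NU * NV) := by
        rw [hre, him]
        exact add_le_add ((abs_add_le _ _).trans (add_le_add e1 e2))
          ((abs_sub _ _).trans (add_le_add e3 e4))
    _ = 4 * M * NU * NV := by ring

/-- A sum over a finset rewritten as a sum over `Fin (card)`. [folklore] -/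
theorem sum_finset_eq_sum_fin {β : Type*} [AddCommMonoid β] (s : Finset X) (f : X → β) :
    ∑ x ∈ s, f x = ∑ i : Fin s.card, f (s.equivFin.symm i) := by
  rw [← Finset.sum_coe_sort]
  exact (Fintype.sum_equiv s.equivFin.symm (fun i => f (s.equivFin.symm i)) (fun x => f x)
    (fun i => rfl)).symm

/-- **Operators from real matrix bounds.** Kernel vectors with real Gram matrix, a real matrix `m`
bounded over real coefficient families by `M ‖·‖ ‖·‖`: there is a bounded operator `T` with
`⟪δₓ, T δᵧ⟫ = m x y` and `‖T‖ ≤ 4M` (`norm_sum_sum_conj_mul_le_of_real` + `exists_clm_of_inner_bound`).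
This is how the Osterwalder–Schrader calculus turns correlation-function inequalities (stated with real
coefficients) into operators. [cite: GlimmJaffe1987, §19.1] -/
theorem exists_clm_of_real_bound [CompleteSpace H] (δ : X → H)
    (hδ : DenseRange (Finsupp.linearCombination ℂ δ)) (hreal : ∀ x y, (⟪δ x, δ y⟫_ℂ).im = 0)
    (m : X → X → ℝ) {M : ℝ} (hM : 0 ≤ M)
    (hb : ∀ (k : ℕ) (xs : Fin k → X) (r : Fin k → ℝ) (l : ℕ) (ys : Fin l → X) (r' : Fin l → ℝ),
      |∑ i, ∑ j, r i * r' j * m (xs i) (ys j)| ≤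
        M * ‖∑ i, (r i : ℂ) • δ (xs i)‖ * ‖∑ j, (r' j : ℂ) • δ (ys j)‖) :
    ∃ T : H →L[ℂ] H, (∀ x y, ⟪δ x, T (δ y)⟫_ℂ = m x y) ∧ ‖T‖ ≤ 4 * M := by
  obtain ⟨T, hT, hTn⟩ := exists_clm_of_inner_bound δ hδ (fun x y => (m x y : ℂ)) (M := 4 * M)
    (by positivity) (fun c c' => by
      have key := norm_sum_sum_conj_mul_le_of_real δ hreal m hM hb (k := c.support.card)
        (fun i => (c.support.equivFin.symm i : X)) (fun i => c (c.support.equivFin.symm i))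
        (l := c'.support.card)
        (fun j => (c'.support.equivFin.symm j : X)) (fun j => c' (c'.support.equivFin.symm j))
      rw [sum_finset_eq_sum_fin c.support]
      simp only [sum_finset_eq_sum_fin c'.support]
      convert key using 3
      · rw [Finsupp.linearCombination_apply, Finsupp.sum, sum_finset_eq_sum_fin c.support]
      · rw [Finsupp.linearCombination_apply, Finsupp.sum, sum_finset_eq_sum_fin c'.support])
  exact ⟨T, fun x y => hT x y, hTn⟩

end KernelVectors

end Literature.Analysis.OperatorTheory
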